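import Summits.QuantumFields.YangMills.Theorems.BalabanUVNodesN11TStepOldBranchPrivateInnerChartOfLaws
import Summits.QuantumFields.YangMills.Theorems.BalabanUVNodesN11OperandRowAtHistoryOfTermRows

/-!
# DAG node N11 — THE (O3′) DISJUNCTION AT A v1.7 PARAMETER, INSIDE STEP IN PRIVATE COORDINATES, `_of_provisos`: dag-n11-d's `…PrivateInnerChartOfLaws` ★★★★★★★ with EVERY
# bookkeeping row discharged (`hG`, `hZ`, `hw0`, `hwm`, `hχm` ⟸ `θ.Provisos₁₃CoPH`; `hgm` ⟸ residual ∕ operand rows; operand rows ⟸ `TermRowsAt`)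

HEADER — WORK-UNIT METADATA.  Cell `pub-ymgap`, YM-PLAN Track A (HUMAN RULING D-0062 ∕ D-0149), width seat `pub-ymgap-dag-n11-w2` (g4; WIDTH SEAT 2∕4 on N11 [B14]),
route `BalabanUVNodes`; this seat's jail key is K1⁷ `stmt-QuantumFields-20542` (`--kind proof --supports 20542 --as helper`, count-neutral); the K1 face of record since
KEY MAP v2 is K1⁹ `StabilityBRunRowsAtRecordR13SepCoPHV` = stmt-QuantumFields-27364 (MIS-KEY ∕ VALID rule R463 (4)(a): lineage BY NAME).  [I] = [Balaban1987RG1], [III] =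
[Balaban1988Convergent].  Over dag-n11-d g15's `…TStepOldBranchPrivateInnerChartOfLaws` (★★★★★★★ `slotsTOfRecord₁₃H_succ_O3_of_hasSect2FormAtZS_of_privateInnerChart_of_laws`: the
(O3′) DISJUNCTION with the inside step charted by dag-n11-w6 g2's private coordinates, NO integrability row on the new side — p624357's `_of_laws` bottom), this seat's p626903 (§2
`hgm_at_record₁₃_of_rows`), p628852 (§2 `hG_at_record₁₃_of_provisos`), `…OperandRowAtHistoryOfTermRows` (§1 `operandRows_at_history_of_termRows`), dag-n21-d's `zetaOfRecord_nonneg`,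
def-T's `wOfRecord_nonneg` ∕ `Stage13HParams.Provisos₁₃CoPH.tstep` ∕ `avOfRecord_measurable`, K0c's `localBgMeasurable` + `measurable_chiSeqOfRecord_of_localBg`.  Bus: CLAIM-5 of g4.

WHY THIS FILE.  dag-n11-d's I isolates N11's content «between two explicit integrals»: at a 𝐓-present child the (O3′) clause of `PresentChildObligations` follows from Theorem 1's
level-`k` form, the per-bond inversion data of the (0.4) fibre maps off `sV′` (dag-n09-w6 ∕ dag-n11-w6; at the central window by p629018), the support clause `hwS`, ONE EXPLICIT
INTEGRAL IDENTITY PER OLD BRANCH `hinner₀` ([I] §2 + Jacobian + gauge fixing + `ζ` + [III] Thm 2 — DISPLAYED), and a list of bookkeeping rows: `hG` (graph integrability of the step),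
`hZ` (residual law), `hw0` ∕ `hwm` ∕ `hχm` (sign and measurability of the step weight's graph section and of `χ_k`), `hζ0m` ∕ `hqm` ∕ `hΦ₀m` (residual serving `init s′`, old operand),
`hgm` (joint measurability of the new inside integrands).  THIS FILE removes the bookkeeping: `hG`, `hZ`, `hw0`, `hwm`, `hχm` are theorems of `θ.Provisos₁₃CoPH` (p628852 §2; row
`zhLaws`; `zetaUnity` ∕ `zetaAbs` via `zetaOfRecord_nonneg` + `wOfRecord_nonneg`; `Provisos₁₃CoPH.tstep.measW` read on the graph of `avOfRecord`; K0c's (H-U) theorem), `hgm` follows from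
the residual-measurability rows for `s′` and the new-operand row (p626903 §2), and both operand rows follow from dag-n11-w3's `TermRowsAt` (`…OperandRowAtHistoryOfTermRows` §1).

WHAT THIS FILE PROVES (0 `sorry`, 0 `def`, standard axioms).
★★★★★★★ `slotsTOfRecord₁₃H_succ_O3_of_hasSect2FormAtZS_of_privateInnerChart_of_provisos` — dag-n11-d's I with `hG hZ hw0 hwm hχm` ↦ `h : θ.Provisos₁₃CoPH F N` and `hgm` ↦ `hζm` ∕
`hqm'` ∕ `hΦm`; displayed: `h`, `hform`, `hζ0m` ∕ `hqm` ∕ `hΦ₀m`, `hζm` ∕ `hqm'` ∕ `hΦm`, the per-bond data `hβ' Ω T ϑ jd hΩm hTm hθm hjm hΩbl hright hlaw`, `hwS`, `hinner₀`.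
★★★★★★★ `…_of_provisos_of_termRows` — the same with `hΦ₀m` ⟸ `TermRowsAt θ p (t s′.init) j` (`1 ≤ j ≤ k`) and `hΦm` ⟸ `TermRowsAt θ p t′ j` (`1 ≤ j ≤ k+1`).
NET: on the private-coordinate road the (O3′) DISJUNCTION reads from `θ.Provisos₁₃CoPH` + `hform` + four `ResidualRowsAt`-shape measurability rows + two `TermRowsAt` families + the
per-bond inversion data (p629018 supplies them at the central window) + the support clause `hwS` + `hinner₀` — THE MATHEMATICS — only.

HONEST FRAMING.  Helper lane, count-neutral; ONE composition each, BY NAME; per-bond data, `hwS`, rows, the level-`k` form and the integral identity DISPLAYED; NO chart of Bałaban's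
((47), [III] (3.10)–(3.25)) asserted — dag-n11-w6's is a valid chart of the disintegration, not print's; NO Jacobian evaluated; NO Gaussian integration; nothing of [I] §2 ∕ [III] §3 ∕
Thm 2 asserted; (B4) ∕ (S-α) ∕ (O3′) NOT closed; N11 NOT discharged; K1⁹ NOT closed, no registered stub touched; counts unmoved (typed 28∕28 · discharged 5∕27 · A 5∕28).  One finite
`𝕋⁴_{L^K}` programme at fixed `ε = L^{−K}`; R4 closes only the conditional finite-𝕋⁴ rung `BalabanLadder.UV` — NOT ℝ⁴, NOT OS, NOT a mass gap, NOT Clay.  No `sorry`, `axiom`, `def`,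
`instance`, `notation`.  Sources (SHAPE ∕ bookkeeping only): [I] (0.4) p.253, (2.4) p.266, (2.10) p.267; [III] Thm 1 p.262, Thm 2 p.263, §3 p.279, (2.18) p.257, (2.20)–(2.21) p.258,
(3.1) p.264, (3.2)–(3.9) pp.265–266, (3.16) p.268, (3.24)–(3.25) p.270.
-/

noncomputable section

open MeasureTheory ProbabilityTheory Set Function
open scoped ENNReal NNReal BigOperators Matrix.Norms.L2Operator

namespace Summit.QuantumFields.YangMills.Theorems.BalabanUVNodesN11TStepOldBranchPrivateInnerChartOfProvisos

open Literature.MathematicalPhysics.QuantumFieldTheory.Balaban1983to89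
open Literature.MathematicalPhysics.QuantumFieldTheory.Balaban1983to89.T4AveragingDisintegration
open BalabanUVNodesN11TStepOldBranchPrivateInnerChartOfLaws (slotsTOfRecord₁₃H_succ_O3_of_hasSect2FormAtZS_of_privateInnerChart_of_laws)
open BalabanUVNodesN11TStepBranchSumAtRecord13OfLaws (hgm_at_record₁₃_of_rows)
open BalabanUVNodesN11TStepGraphIntegrableOfProvisos (hG_at_record₁₃_of_provisos)
open BalabanUVNodesN11OperandRowAtHistoryOfTermRows (operandRows_at_history_of_termRows)
open BalabanUVNodesN11Sect3SupplyChainTermRows (TermRowsAt)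
open N21StepWeightsPositivity (zetaOfRecord_nonneg)
open Literature.MathematicalPhysics.QuantumFieldTheory.Balaban1983to89.BlockAveragingHaarAC (centralBond)
open Node00 hiding SU
open Node00.Tk T4Continuum B14.Eq218Concrete
open B10Eq42TorusConstraint (bondsIn)

variable {F : T4Family} {N : ℕ} [NeZero N]

/-- ★★★★★★★ **THE (O3′) DISJUNCTION AT A v1.7 PARAMETER, INSIDE STEP IN PRIVATE COORDINATES, `_of_provisos`**: dag-n11-d's
`…PrivateInnerChartOfLaws.slotsTOfRecord₁₃H_succ_O3_of_hasSect2FormAtZS_of_privateInnerChart_of_laws` with its bookkeeping rows discharged — `hG` (p628852 §2), `hZ` (row `zhLaws`),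
`0 ≤ w` (`zetaOfRecord_nonneg` + `wOfRecord_nonneg`), `w`'s graph section measurable (`Provisos₁₃CoPH.tstep.measW` on the graph of `avOfRecord`), `χ_k` measurable (K0c's
`localBgMeasurable`) from `h : θ.Provisos₁₃CoPH F N`; `hgm` from the residual-measurability rows for `s′` and the new-operand row (p626903 §2).  Displayed: `h`, `hform`, the rows
`hζ0m` ∕ `hqm` ∕ `hΦ₀m` and `hζm` ∕ `hqm'` ∕ `hΦm`, the per-bond inversion data, the support clause `hwS`, and THE integral identity `hinner₀`.
[cite: Balaban1988Convergent, Thm 1 p.262, Thm 2 p.263, §3 p.279, (3.24)–(3.25) p.270, (2.18) p.257, (2.20)–(2.21) p.258, (3.1) p.264, (3.2)–(3.9) pp.265–266; Balaban1987RG1, (0.4) p.253, (2.10) p.267] -/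
theorem slotsTOfRecord₁₃H_succ_O3_of_hasSect2FormAtZS_of_privateInnerChart_of_provisos (θ : Stage13HParams F N) (h : θ.Provisos₁₃CoPH F N)
    (p : B12.RunParams) {k : ℕ} (hkK : k < p.K)
    {hdec : DecidableEq (PBond (F.P p.K) k)} {hdec' : DecidableEq (PBond (F.P p.K) (k + 1))} (hk : k + 1 ≤ (F.P p.K).m + (F.P p.K).K)
    (s' : SeqOfRecord F θ.ν θ.τ9.M (gOfRecord₁₃ F N θ.toStage13Params p) p.K (k + 1))
    {law : SeqOfRecord F θ.ν θ.τ9.M (gOfRecord₁₃ F N θ.toStage13Params p) p.K k → Sect2.TermValues (F.P p.K) (MatA N) (FluctV N) θ.τ9.M → Prop}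
    {t : SeqOfRecord F θ.ν θ.τ9.M (gOfRecord₁₃ F N θ.toStage13Params p) p.K k → Sect2.TermValues (F.P p.K) (MatA N) (FluctV N) θ.τ9.M}
    {Ek : SeqOfRecord F θ.ν θ.τ9.M (gOfRecord₁₃ F N θ.toStage13Params p) p.K k → ℝ}
    (hform : HasSect2FormAtZS F N (FluctV N) p.K (settingOfRecord₁₃ F N θ.toStage13Params p) k (θ.rzAt p) (WtOfRecord₁₃H F N θ p)
      (UbgOfRecord₁₃CoP F N θ.toStage13Params p k) law
      (slotsOfRecord F N θ.ν θ.τ9 (EOfRecord₁₃ F N θ.toStage13Params) (wOfRecord₉ F N θ.toStage9Params) θ.ppSel p (gOfRecord₁₃ F N θ.toStage13Params p) k) t Ek)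
    (t' : Sect2.TermValues (F.P p.K) (MatA N) (FluctV N) θ.τ9.M) (E' : ℝ)
    -- measurability rows (dag-n11-e's `ResidualRowsAt` ∕ `OperandRowsAt` shapes): the residuals serving `init s′` and `s′`, the OLD and the NEW operand
    (hζ0m : ∀ j Y, Measurable ((θ.zhAt p s'.init).ζ0 j Y)) (hqm : ∀ j Λ', Measurable ((θ.zhAt p s'.init).quad j Λ'))
    (hΦ₀m : ∀ S₀ ∈ admSOfRecord F θ.ν θ.τ9.M (gOfRecord₁₃ F N θ.toStage13Params p) p.K k s'.init,
      Measurable fun ω : MultiCfg (F.P p.K) (SU N) (FluctV N) =>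
        (sect2Operand F N (FluctV N) p.K (settingOfRecord₁₃ F N θ.toStage13Params p) (θ.rzAt p s'.init) s'.init (t s'.init) (Ek s'.init)
            (UbgOfRecord₁₃CoP F N θ.toStage13Params p k s'.init)) (S₀, fun j => (ω j).2) (fun j => (ω j).1))
    (hζm : ∀ j Y, Measurable ((θ.zhAt p s').ζ0 j Y)) (hqm' : ∀ j Λ', Measurable ((θ.zhAt p s').quad j Λ'))
    (hΦm : ∀ S ∈ admSOfRecord F θ.ν θ.τ9.M (gOfRecord₁₃ F N θ.toStage13Params p) p.K (k + 1) s',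
      Measurable fun ω : MultiCfg (F.P p.K) (SU N) (FluctV N) =>
        (sect2Operand F N (FluctV N) p.K (settingOfRecord₁₃ F N θ.toStage13Params p) (θ.rzAt p s') s' t' E'
            (UbgOfRecord₁₃CoP F N θ.toStage13Params p (k + 1) s')) (S, fun j => (ω j).2) (fun j => (ω j).1))
    -- dag-n11-w6 ∕ dag-n09-w6's per-bond inversion data of the (0.4) fibre maps, used only at the coarse bonds off `sV′`
    (hβ' : ∀ c : PBond (F.P p.K) (k + 1), c ∉ (Set.toFinite (bondsIn (k + 1) (s'.Ω (k + 1))ᶜ)).toFinset → centralBond c ∉ (Set.toFinite (bondsIn k (s'.Ω (k + 1))ᶜ)).toFinset)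
    (Ω T : PBond (F.P p.K) (k + 1) → GaugeField (F.P p.K) k (SU N) → Set (SU N))
    (ϑ : PBond (F.P p.K) (k + 1) → GaugeField (F.P p.K) k (SU N) → SU N → SU N)
    (jd : PBond (F.P p.K) (k + 1) → GaugeField (F.P p.K) k (SU N) → SU N → ℝ≥0)
    (hΩm : ∀ c, MeasurableSet {p : GaugeField (F.P p.K) k (SU N) × SU N | p.2 ∈ Ω c p.1})
    (hTm : ∀ c, MeasurableSet {p : GaugeField (F.P p.K) k (SU N) × SU N | p.2 ∈ T c p.1})
    (hθm : ∀ c, Measurable fun p : GaugeField (F.P p.K) k (SU N) × SU N => ϑ c p.1 p.2)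
    (hjm : ∀ c, Measurable fun p : GaugeField (F.P p.K) k (SU N) × SU N => jd c p.1 p.2)
    (hΩbl : ∀ c (U : GaugeField (F.P p.K) k (SU N)) (g' : PBond (F.P p.K) (k + 1) → SU N), Ω c (extend centralBond g' U) = Ω c U)
    (hright : ∀ c U, ∀ v ∈ T c U, (avOfRecord F N p.K k).avg (update U (centralBond c) (ϑ c U v)) c = v)
    (hlaw : ∀ c U, (HaarData.haar : Measure (SU N)).restrict (Ω c U) =
      (((HaarData.haar : Measure (SU N)).restrict (T c U)).withDensity fun v => (jd c U v : ℝ≥0∞)).map (ϑ c U))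
    -- the support clause ((3.2)–(3.5))
    (hwS : ∀ q : (↥(Set.toFinite (bondsIn k (s'.Ω (k + 1))ᶜ)).toFinset → SU N) × ({b : PBond (F.P p.K) k // b ∉ (Set.toFinite (bondsIn k (s'.Ω (k + 1))ᶜ)).toFinset} → SU N),
      wOfRecord₉ F N θ.toStage9Params p (gOfRecord₁₃ F N θ.toStage13Params p) k s' (⇑(MeasurableEquiv.piEquivPiSubtypeProd (fun _ : PBond (F.P p.K) k => SU N)
            (· ∈ (Set.toFinite (bondsIn k (s'.Ω (k + 1))ᶜ)).toFinset)).symm q) ((avOfRecord F N p.K k).avg (⇑(MeasurableEquiv.piEquivPiSubtypeProd (fun _ : PBond (F.P p.K) k => SU N)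
            (· ∈ (Set.toFinite (bondsIn k (s'.Ω (k + 1))ᶜ)).toFinset)).symm q)) ≠ 0 →
        ∀ c : {c : PBond (F.P p.K) (k + 1) // c ∉ (Set.toFinite (bondsIn (k + 1) (s'.Ω (k + 1))ᶜ)).toFinset}, q.2 ⟨centralBond (c : PBond (F.P p.K) (k + 1)), hβ' c c.2⟩ ∈ Ω c ((MeasurableEquiv.piEquivPiSubtypeProd (fun _ : PBond (F.P p.K) k => SU N) (· ∈ (Set.toFinite (bondsIn k (s'.Ω (k + 1))ᶜ)).toFinset)).symm q))
    -- THE EXPLICIT INTEGRAL IDENTITY PER OLD BRANCH ([I] §2 + gauge fixing + ζ + [III] Thm 2 — displayed)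
    (hinner₀ : ∀ᵐ q ∂((Measure.pi fun _ : ↥(Set.toFinite (bondsIn (k + 1) (s'.Ω (k + 1))ᶜ)).toFinset => (HaarData.haar : Measure (SU N))).prod
          (Measure.pi fun _ : {c : PBond (F.P p.K) (k + 1) // c ∉ (Set.toFinite (bondsIn (k + 1) (s'.Ω (k + 1))ᶜ)).toFinset} =>
            (HaarData.haar : Measure (SU N)))),
      ∀ S₀ ∈ admSOfRecord F θ.ν θ.τ9.M (gOfRecord₁₃ F N θ.toStage13Params p) p.K k s'.init, ∀ y : ↥(Set.toFinite (bondsIn k (s'.Ω (k + 1))ᶜ)).toFinset → SU N,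
        avgRestrOfRecord F N p.K k (Set.toFinite (bondsIn k (s'.Ω (k + 1))ᶜ)).toFinset (Set.toFinite (bondsIn (k + 1) (s'.Ω (k + 1))ᶜ)).toFinset y = q.1 →
        (∫ r : ({b : PBond (F.P p.K) k // b ∉ (Set.toFinite (bondsIn k (s'.Ω (k + 1))ᶜ)).toFinset} → SU N), (({z : ((↥(Set.toFinite (bondsIn k (s'.Ω (k + 1))ᶜ)).toFinset → SU N) × ({c : PBond (F.P p.K) (k + 1) // c ∉ (Set.toFinite (bondsIn (k + 1) (s'.Ω (k + 1))ᶜ)).toFinset} → SU N)) × ({b : PBond (F.P p.K) k // b ∉ (Set.toFinite (bondsIn k (s'.Ω (k + 1))ᶜ)).toFinset} → SU N) |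
              ∀ c : {c : PBond (F.P p.K) (k + 1) // c ∉ (Set.toFinite (bondsIn (k + 1) (s'.Ω (k + 1))ᶜ)).toFinset}, z.1.2 c ∈ T c ((MeasurableEquiv.piEquivPiSubtypeProd (fun _ : PBond (F.P p.K) k => SU N) (· ∈ (Set.toFinite (bondsIn k (s'.Ω (k + 1))ᶜ)).toFinset)).symm (z.1.1, z.2))}.indicator
            (fun z => ∏ c : {c : PBond (F.P p.K) (k + 1) // c ∉ (Set.toFinite (bondsIn (k + 1) (s'.Ω (k + 1))ᶜ)).toFinset}, jd c ((MeasurableEquiv.piEquivPiSubtypeProd (fun _ : PBond (F.P p.K) k => SU N) (· ∈ (Set.toFinite (bondsIn k (s'.Ω (k + 1))ᶜ)).toFinset)).symm (z.1.1, z.2)) (z.1.2 c)) ((y, q.2), r) : ℝ≥0) : ℝ) *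
          ((fun U => wOfRecord₉ F N θ.toStage9Params p (gOfRecord₁₃ F N θ.toStage13Params p) k s' U ((avOfRecord F N p.K k).avg U) *
        (chiSeqOfRecord F N θ.ν θ.τ9.M (gOfRecord₁₃ F N θ.toStage13Params p) p.K k s'.init U *
          tkBranchOfRecord F N (FluctV N) θ.ν θ.τ9.M (gOfRecord₁₃ F N θ.toStage13Params p) p.K (WtOfRecord₁₃H F N θ p s'.init) s'.init S₀ k
            (fun ω => (sect2Operand F N (FluctV N) p.K (settingOfRecord₁₃ F N θ.toStage13Params p) (θ.rzAt p s'.init) s'.init (t s'.init) (Ek s'.init)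
            (UbgOfRecord₁₃CoP F N θ.toStage13Params p k s'.init)) (S₀, fun j => (ω j).2) (fun j => (ω j).1)) (baseCfg k U))) ∘
            ⇑(MeasurableEquiv.piEquivPiSubtypeProd (fun _ : PBond (F.P p.K) k => SU N)
            (· ∈ (Set.toFinite (bondsIn k (s'.Ω (k + 1))ᶜ)).toFinset)).symm) (y, extend (fun c : {c : PBond (F.P p.K) (k + 1) // c ∉ (Set.toFinite (bondsIn (k + 1) (s'.Ω (k + 1))ᶜ)).toFinset} =>
            (⟨centralBond (c : PBond (F.P p.K) (k + 1)), hβ' c c.2⟩ : {b : PBond (F.P p.K) k // b ∉ (Set.toFinite (bondsIn k (s'.Ω (k + 1))ᶜ)).toFinset}))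
            (fun c : {c : PBond (F.P p.K) (k + 1) // c ∉ (Set.toFinite (bondsIn (k + 1) (s'.Ω (k + 1))ᶜ)).toFinset} => ϑ c ((MeasurableEquiv.piEquivPiSubtypeProd (fun _ : PBond (F.P p.K) k => SU N) (· ∈ (Set.toFinite (bondsIn k (s'.Ω (k + 1))ᶜ)).toFinset)).symm (y, r)) (q.2 c)) r) ∂(Measure.pi fun _ : {b : PBond (F.P p.K) k // b ∉ (Set.toFinite (bondsIn k (s'.Ω (k + 1))ᶜ)).toFinset} => (HaarData.haar : Measure (SU N)))) =
          ∑ Y ∈ (Set.toFinite {Y : Set (Site (F.P p.K) 0) | Y ∈ SClassOfRecord F θ.ν (gOfRecord₁₃ F N θ.toStage13Params p) p.K (k + 1) ∧ Y ⊆ s'.Ω (k + 1) ∩ (s'.Λ (k + 1))ᶜ}).toFinset,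
            zetaOp (genDataOfRecord F N (FluctV N) θ.ν θ.τ9.M (gOfRecord₁₃ F N θ.toStage13Params p) p.K (WtOfRecord₁₃H F N θ p s') s' (Function.update S₀ (k + 1) Y) k).ζ
              (aOp k (genDataOfRecord F N (FluctV N) θ.ν θ.τ9.M (gOfRecord₁₃ F N θ.toStage13Params p) p.K (WtOfRecord₁₃H F N θ p s') s' (Function.update S₀ (k + 1) Y) k).sA
                (genDataOfRecord F N (FluctV N) θ.ν θ.τ9.M (gOfRecord₁₃ F N θ.toStage13Params p) p.K (WtOfRecord₁₃H F N θ p s') s' (Function.update S₀ (k + 1) Y) k).w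
                (tkBranchOfRecord F N (FluctV N) θ.ν θ.τ9.M (gOfRecord₁₃ F N θ.toStage13Params p) p.K (WtOfRecord₁₃H F N θ p s') s'.init S₀ k
                  (fun ω => (sect2Operand F N (FluctV N) p.K (settingOfRecord₁₃ F N θ.toStage13Params p) (θ.rzAt p s') s' t' E'
                  (UbgOfRecord₁₃CoP F N θ.toStage13Params p (k + 1) s')) (Function.update S₀ (k + 1) Y, fun j => (ω j).2) (fun j => (ω j).1))))
              (Function.update (baseCfg (k + 1) ((MeasurableEquiv.piEquivPiSubtypeProd (fun _ : PBond (F.P p.K) (k + 1) => SU N)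
                (· ∈ (Set.toFinite (bondsIn (k + 1) (s'.Ω (k + 1))ᶜ)).toFinset)).symm q)) k
              (Function.updateFinset ((baseCfg (V := FluctV N) (k + 1) ((MeasurableEquiv.piEquivPiSubtypeProd (fun _ : PBond (F.P p.K) (k + 1) => SU N)
                (· ∈ (Set.toFinite (bondsIn (k + 1) (s'.Ω (k + 1))ᶜ)).toFinset)).symm q)) k).1 (Set.toFinite (bondsIn k (s'.Ω (k + 1))ᶜ)).toFinset y,
                ((baseCfg (V := FluctV N) (k + 1) ((MeasurableEquiv.piEquivPiSubtypeProd (fun _ : PBond (F.P p.K) (k + 1) => SU N)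
                (· ∈ (Set.toFinite (bondsIn (k + 1) (s'.Ω (k + 1))ᶜ)).toFinset)).symm q)) k).2))) :
    slotsTOfRecord F N θ.ν θ.τ9 (EOfRecord₁₃ F N θ.toStage13Params) (wOfRecord₉ F N θ.toStage9Params) θ.ppSel p (gOfRecord₁₃ F N θ.toStage13Params p) (k + 1) s' = 0 ∨
      ∀ᵐ V' ∂fieldMeasure (F.P p.K) (k + 1) (SU N),
        chiSeqOfRecord F N θ.ν θ.τ9.M (gOfRecord₁₃ F N θ.toStage13Params p) p.K (k + 1) s' V' ≠ 0 →
          slotsTOfRecord F N θ.ν θ.τ9 (EOfRecord₁₃ F N θ.toStage13Params) (wOfRecord₉ F N θ.toStage9Params) θ.ppSel p (gOfRecord₁₃ F N θ.toStage13Params p) (k + 1) s' V' =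
            sect2Slot F N (FluctV N) p.K (settingOfRecord₁₃ F N θ.toStage13Params p) (θ.rzAt p s') (WtOfRecord₁₃H F N θ p s') s' t' E'
              (UbgOfRecord₁₃CoP F N θ.toStage13Params p (k + 1) s') V' := by
  -- the rows `hG`, `hZ`, `0 ≤ w`, measurability of `w`'s graph section and of `χ_k`, and `hgm` are THEOREMS (this seat's p628852 §2, the core row `zhLaws`, dag-n21-d's
  -- `zetaOfRecord_nonneg` + def-T's `wOfRecord_nonneg`, `Provisos₁₃CoPH.tstep.measW` on the graph of `avOfRecord`, K0c's `localBgMeasurable`, and p626903 §2)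
  have hζ0 := zetaOfRecord_nonneg F N θ.ν θ.τ9.M h.zetaUnity h.zetaAbs
  have hW2 := (h.tstep p k hkK).measW s'
  have hgr : Measurable fun U : GaugeField (F.P p.K) k (SU N) => ((avOfRecord F N p.K k).avg U, U) :=
    (avOfRecord_measurable F N p.K k).prodMk measurable_id
  have hwm : Measurable fun U => wOfRecord₉ F N θ.toStage9Params p (gOfRecord₁₃ F N θ.toStage13Params p) k s' U ((avOfRecord F N p.K k).avg U) := by
    have h' := hW2.comp hgr  -- elaborated WITHOUT the expected type (else the unifier unfolds `wOfRecord`'s label sum)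
    exact h'
  exact slotsTOfRecord₁₃H_succ_O3_of_hasSect2FormAtZS_of_privateInnerChart_of_laws θ p hkK (hdec := hdec) (hdec' := hdec') hk s' hform t' E'
    (hG_at_record₁₃_of_provisos θ h p hkK s') h.zhLaws (fun U => wOfRecord_nonneg F N θ.ν θ.τ9.M p _ k θ.A₁ hζ0 s' U _) hwm
    (measurable_chiSeqOfRecord_of_localBg (localBgMeasurable F N θ.ν) θ.τ9.M _ p.K k s'.init) hζ0m hqm hΦ₀m hβ' Ω T ϑ jd hΩm hTm hθm hjm hΩbl hright hlaw hwS
    (hgm_at_record₁₃_of_rows θ p (hdec := hdec) (hdec' := hdec') s' t' E' hζm hqm' hΦm) hinner₀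

/-- ★★★★★★★ **THE SAME, OPERAND ROWS FROM TERM ROWS**: `hΦ₀m` READ FROM `TermRowsAt θ p (t s′.init) j` (`1 ≤ j ≤ k`) and `hΦm` READ FROM `TermRowsAt θ p t′ j` (`1 ≤ j ≤ k+1`) by
`…OperandRowAtHistoryOfTermRows` §1 at the histories `init s′` and `s′`. [cite: Balaban1988Convergent, Thm 2 p.263, §3 p.279, (3.24)–(3.25) p.270, (2.23)–(2.27) pp.258–259, (2.30)–(2.31) p.260, (2.40)–(2.41) p.261] -/
theorem slotsTOfRecord₁₃H_succ_O3_of_hasSect2FormAtZS_of_privateInnerChart_of_provisos_of_termRows (θ : Stage13HParams F N) (h : θ.Provisos₁₃CoPH F N)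
    (p : B12.RunParams) {k : ℕ} (hkK : k < p.K)
    {hdec : DecidableEq (PBond (F.P p.K) k)} {hdec' : DecidableEq (PBond (F.P p.K) (k + 1))} (hk : k + 1 ≤ (F.P p.K).m + (F.P p.K).K)
    (s' : SeqOfRecord F θ.ν θ.τ9.M (gOfRecord₁₃ F N θ.toStage13Params p) p.K (k + 1))
    {law : SeqOfRecord F θ.ν θ.τ9.M (gOfRecord₁₃ F N θ.toStage13Params p) p.K k → Sect2.TermValues (F.P p.K) (MatA N) (FluctV N) θ.τ9.M → Prop}
    {t : SeqOfRecord F θ.ν θ.τ9.M (gOfRecord₁₃ F N θ.toStage13Params p) p.K k → Sect2.TermValues (F.P p.K) (MatA N) (FluctV N) θ.τ9.M}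
    {Ek : SeqOfRecord F θ.ν θ.τ9.M (gOfRecord₁₃ F N θ.toStage13Params p) p.K k → ℝ}
    (hform : HasSect2FormAtZS F N (FluctV N) p.K (settingOfRecord₁₃ F N θ.toStage13Params p) k (θ.rzAt p) (WtOfRecord₁₃H F N θ p)
      (UbgOfRecord₁₃CoP F N θ.toStage13Params p k) law
      (slotsOfRecord F N θ.ν θ.τ9 (EOfRecord₁₃ F N θ.toStage13Params) (wOfRecord₉ F N θ.toStage9Params) θ.ppSel p (gOfRecord₁₃ F N θ.toStage13Params p) k) t Ek)
    (t' : Sect2.TermValues (F.P p.K) (MatA N) (FluctV N) θ.τ9.M) (E' : ℝ)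
    -- measurability of the residuals serving `init s′` and `s′` (dag-n11-e's `ResidualRowsAt` shapes) + dag-n11-w3's TERM ROWS of the old and new witness values
    (hζ0m : ∀ j Y, Measurable ((θ.zhAt p s'.init).ζ0 j Y)) (hqm : ∀ j Λ', Measurable ((θ.zhAt p s'.init).quad j Λ'))
    (hζm : ∀ j Y, Measurable ((θ.zhAt p s').ζ0 j Y)) (hqm' : ∀ j Λ', Measurable ((θ.zhAt p s').quad j Λ'))
    (htrows₀ : ∀ j, 1 ≤ j → j ≤ k → TermRowsAt θ p (t s'.init) j) (htrows : ∀ j, 1 ≤ j → j ≤ k + 1 → TermRowsAt θ p t' j)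
    -- dag-n11-w6 ∕ dag-n09-w6's per-bond inversion data of the (0.4) fibre maps, used only at the coarse bonds off `sV′`
    (hβ' : ∀ c : PBond (F.P p.K) (k + 1), c ∉ (Set.toFinite (bondsIn (k + 1) (s'.Ω (k + 1))ᶜ)).toFinset → centralBond c ∉ (Set.toFinite (bondsIn k (s'.Ω (k + 1))ᶜ)).toFinset)
    (Ω T : PBond (F.P p.K) (k + 1) → GaugeField (F.P p.K) k (SU N) → Set (SU N))
    (ϑ : PBond (F.P p.K) (k + 1) → GaugeField (F.P p.K) k (SU N) → SU N → SU N)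
    (jd : PBond (F.P p.K) (k + 1) → GaugeField (F.P p.K) k (SU N) → SU N → ℝ≥0)
    (hΩm : ∀ c, MeasurableSet {p : GaugeField (F.P p.K) k (SU N) × SU N | p.2 ∈ Ω c p.1})
    (hTm : ∀ c, MeasurableSet {p : GaugeField (F.P p.K) k (SU N) × SU N | p.2 ∈ T c p.1})
    (hθm : ∀ c, Measurable fun p : GaugeField (F.P p.K) k (SU N) × SU N => ϑ c p.1 p.2)
    (hjm : ∀ c, Measurable fun p : GaugeField (F.P p.K) k (SU N) × SU N => jd c p.1 p.2)
    (hΩbl : ∀ c (U : GaugeField (F.P p.K) k (SU N)) (g' : PBond (F.P p.K) (k + 1) → SU N), Ω c (extend centralBond g' U) = Ω c U)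
    (hright : ∀ c U, ∀ v ∈ T c U, (avOfRecord F N p.K k).avg (update U (centralBond c) (ϑ c U v)) c = v)
    (hlaw : ∀ c U, (HaarData.haar : Measure (SU N)).restrict (Ω c U) =
      (((HaarData.haar : Measure (SU N)).restrict (T c U)).withDensity fun v => (jd c U v : ℝ≥0∞)).map (ϑ c U))
    -- the support clause ((3.2)–(3.5))
    (hwS : ∀ q : (↥(Set.toFinite (bondsIn k (s'.Ω (k + 1))ᶜ)).toFinset → SU N) × ({b : PBond (F.P p.K) k // b ∉ (Set.toFinite (bondsIn k (s'.Ω (k + 1))ᶜ)).toFinset} → SU N),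
      wOfRecord₉ F N θ.toStage9Params p (gOfRecord₁₃ F N θ.toStage13Params p) k s' (⇑(MeasurableEquiv.piEquivPiSubtypeProd (fun _ : PBond (F.P p.K) k => SU N)
            (· ∈ (Set.toFinite (bondsIn k (s'.Ω (k + 1))ᶜ)).toFinset)).symm q) ((avOfRecord F N p.K k).avg (⇑(MeasurableEquiv.piEquivPiSubtypeProd (fun _ : PBond (F.P p.K) k => SU N)
            (· ∈ (Set.toFinite (bondsIn k (s'.Ω (k + 1))ᶜ)).toFinset)).symm q)) ≠ 0 →
        ∀ c : {c : PBond (F.P p.K) (k + 1) // c ∉ (Set.toFinite (bondsIn (k + 1) (s'.Ω (k + 1))ᶜ)).toFinset}, q.2 ⟨centralBond (c : PBond (F.P p.K) (k + 1)), hβ' c c.2⟩ ∈ Ω c ((MeasurableEquiv.piEquivPiSubtypeProd (fun _ : PBond (F.P p.K) k => SU N) (· ∈ (Set.toFinite (bondsIn k (s'.Ω (k + 1))ᶜ)).toFinset)).symm q))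
    -- THE EXPLICIT INTEGRAL IDENTITY PER OLD BRANCH ([I] §2 + gauge fixing + ζ + [III] Thm 2 — displayed)
    (hinner₀ : ∀ᵐ q ∂((Measure.pi fun _ : ↥(Set.toFinite (bondsIn (k + 1) (s'.Ω (k + 1))ᶜ)).toFinset => (HaarData.haar : Measure (SU N))).prod
          (Measure.pi fun _ : {c : PBond (F.P p.K) (k + 1) // c ∉ (Set.toFinite (bondsIn (k + 1) (s'.Ω (k + 1))ᶜ)).toFinset} =>
            (HaarData.haar : Measure (SU N)))),
      ∀ S₀ ∈ admSOfRecord F θ.ν θ.τ9.M (gOfRecord₁₃ F N θ.toStage13Params p) p.K k s'.init, ∀ y : ↥(Set.toFinite (bondsIn k (s'.Ω (k + 1))ᶜ)).toFinset → SU N,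
        avgRestrOfRecord F N p.K k (Set.toFinite (bondsIn k (s'.Ω (k + 1))ᶜ)).toFinset (Set.toFinite (bondsIn (k + 1) (s'.Ω (k + 1))ᶜ)).toFinset y = q.1 →
        (∫ r : ({b : PBond (F.P p.K) k // b ∉ (Set.toFinite (bondsIn k (s'.Ω (k + 1))ᶜ)).toFinset} → SU N), (({z : ((↥(Set.toFinite (bondsIn k (s'.Ω (k + 1))ᶜ)).toFinset → SU N) × ({c : PBond (F.P p.K) (k + 1) // c ∉ (Set.toFinite (bondsIn (k + 1) (s'.Ω (k + 1))ᶜ)).toFinset} → SU N)) × ({b : PBond (F.P p.K) k // b ∉ (Set.toFinite (bondsIn k (s'.Ω (k + 1))ᶜ)).toFinset} → SU N) |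
              ∀ c : {c : PBond (F.P p.K) (k + 1) // c ∉ (Set.toFinite (bondsIn (k + 1) (s'.Ω (k + 1))ᶜ)).toFinset}, z.1.2 c ∈ T c ((MeasurableEquiv.piEquivPiSubtypeProd (fun _ : PBond (F.P p.K) k => SU N) (· ∈ (Set.toFinite (bondsIn k (s'.Ω (k + 1))ᶜ)).toFinset)).symm (z.1.1, z.2))}.indicator
            (fun z => ∏ c : {c : PBond (F.P p.K) (k + 1) // c ∉ (Set.toFinite (bondsIn (k + 1) (s'.Ω (k + 1))ᶜ)).toFinset}, jd c ((MeasurableEquiv.piEquivPiSubtypeProd (fun _ : PBond (F.P p.K) k => SU N) (· ∈ (Set.toFinite (bondsIn k (s'.Ω (k + 1))ᶜ)).toFinset)).symm (z.1.1, z.2)) (z.1.2 c)) ((y, q.2), r) : ℝ≥0) : ℝ) *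
          ((fun U => wOfRecord₉ F N θ.toStage9Params p (gOfRecord₁₃ F N θ.toStage13Params p) k s' U ((avOfRecord F N p.K k).avg U) *
        (chiSeqOfRecord F N θ.ν θ.τ9.M (gOfRecord₁₃ F N θ.toStage13Params p) p.K k s'.init U *
          tkBranchOfRecord F N (FluctV N) θ.ν θ.τ9.M (gOfRecord₁₃ F N θ.toStage13Params p) p.K (WtOfRecord₁₃H F N θ p s'.init) s'.init S₀ k
            (fun ω => (sect2Operand F N (FluctV N) p.K (settingOfRecord₁₃ F N θ.toStage13Params p) (θ.rzAt p s'.init) s'.init (t s'.init) (Ek s'.init)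
            (UbgOfRecord₁₃CoP F N θ.toStage13Params p k s'.init)) (S₀, fun j => (ω j).2) (fun j => (ω j).1)) (baseCfg k U))) ∘
            ⇑(MeasurableEquiv.piEquivPiSubtypeProd (fun _ : PBond (F.P p.K) k => SU N)
            (· ∈ (Set.toFinite (bondsIn k (s'.Ω (k + 1))ᶜ)).toFinset)).symm) (y, extend (fun c : {c : PBond (F.P p.K) (k + 1) // c ∉ (Set.toFinite (bondsIn (k + 1) (s'.Ω (k + 1))ᶜ)).toFinset} =>
            (⟨centralBond (c : PBond (F.P p.K) (k + 1)), hβ' c c.2⟩ : {b : PBond (F.P p.K) k // b ∉ (Set.toFinite (bondsIn k (s'.Ω (k + 1))ᶜ)).toFinset}))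
            (fun c : {c : PBond (F.P p.K) (k + 1) // c ∉ (Set.toFinite (bondsIn (k + 1) (s'.Ω (k + 1))ᶜ)).toFinset} => ϑ c ((MeasurableEquiv.piEquivPiSubtypeProd (fun _ : PBond (F.P p.K) k => SU N) (· ∈ (Set.toFinite (bondsIn k (s'.Ω (k + 1))ᶜ)).toFinset)).symm (y, r)) (q.2 c)) r) ∂(Measure.pi fun _ : {b : PBond (F.P p.K) k // b ∉ (Set.toFinite (bondsIn k (s'.Ω (k + 1))ᶜ)).toFinset} => (HaarData.haar : Measure (SU N)))) =
          ∑ Y ∈ (Set.toFinite {Y : Set (Site (F.P p.K) 0) | Y ∈ SClassOfRecord F θ.ν (gOfRecord₁₃ F N θ.toStage13Params p) p.K (k + 1) ∧ Y ⊆ s'.Ω (k + 1) ∩ (s'.Λ (k + 1))ᶜ}).toFinset,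
            zetaOp (genDataOfRecord F N (FluctV N) θ.ν θ.τ9.M (gOfRecord₁₃ F N θ.toStage13Params p) p.K (WtOfRecord₁₃H F N θ p s') s' (Function.update S₀ (k + 1) Y) k).ζ
              (aOp k (genDataOfRecord F N (FluctV N) θ.ν θ.τ9.M (gOfRecord₁₃ F N θ.toStage13Params p) p.K (WtOfRecord₁₃H F N θ p s') s' (Function.update S₀ (k + 1) Y) k).sA
                (genDataOfRecord F N (FluctV N) θ.ν θ.τ9.M (gOfRecord₁₃ F N θ.toStage13Params p) p.K (WtOfRecord₁₃H F N θ p s') s' (Function.update S₀ (k + 1) Y) k).w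
                (tkBranchOfRecord F N (FluctV N) θ.ν θ.τ9.M (gOfRecord₁₃ F N θ.toStage13Params p) p.K (WtOfRecord₁₃H F N θ p s') s'.init S₀ k
                  (fun ω => (sect2Operand F N (FluctV N) p.K (settingOfRecord₁₃ F N θ.toStage13Params p) (θ.rzAt p s') s' t' E'
                  (UbgOfRecord₁₃CoP F N θ.toStage13Params p (k + 1) s')) (Function.update S₀ (k + 1) Y, fun j => (ω j).2) (fun j => (ω j).1))))
              (Function.update (baseCfg (k + 1) ((MeasurableEquiv.piEquivPiSubtypeProd (fun _ : PBond (F.P p.K) (k + 1) => SU N)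
                (· ∈ (Set.toFinite (bondsIn (k + 1) (s'.Ω (k + 1))ᶜ)).toFinset)).symm q)) k
              (Function.updateFinset ((baseCfg (V := FluctV N) (k + 1) ((MeasurableEquiv.piEquivPiSubtypeProd (fun _ : PBond (F.P p.K) (k + 1) => SU N)
                (· ∈ (Set.toFinite (bondsIn (k + 1) (s'.Ω (k + 1))ᶜ)).toFinset)).symm q)) k).1 (Set.toFinite (bondsIn k (s'.Ω (k + 1))ᶜ)).toFinset y,
                ((baseCfg (V := FluctV N) (k + 1) ((MeasurableEquiv.piEquivPiSubtypeProd (fun _ : PBond (F.P p.K) (k + 1) => SU N)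
                (· ∈ (Set.toFinite (bondsIn (k + 1) (s'.Ω (k + 1))ᶜ)).toFinset)).symm q)) k).2))) :
    slotsTOfRecord F N θ.ν θ.τ9 (EOfRecord₁₃ F N θ.toStage13Params) (wOfRecord₉ F N θ.toStage9Params) θ.ppSel p (gOfRecord₁₃ F N θ.toStage13Params p) (k + 1) s' = 0 ∨
      ∀ᵐ V' ∂fieldMeasure (F.P p.K) (k + 1) (SU N),
        chiSeqOfRecord F N θ.ν θ.τ9.M (gOfRecord₁₃ F N θ.toStage13Params p) p.K (k + 1) s' V' ≠ 0 →
          slotsTOfRecord F N θ.ν θ.τ9 (EOfRecord₁₃ F N θ.toStage13Params) (wOfRecord₉ F N θ.toStage9Params) θ.ppSel p (gOfRecord₁₃ F N θ.toStage13Params p) (k + 1) s' V' =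
            sect2Slot F N (FluctV N) p.K (settingOfRecord₁₃ F N θ.toStage13Params p) (θ.rzAt p s') (WtOfRecord₁₃H F N θ p s') s' t' E'
              (UbgOfRecord₁₃CoP F N θ.toStage13Params p (k + 1) s') V' :=
  slotsTOfRecord₁₃H_succ_O3_of_hasSect2FormAtZS_of_privateInnerChart_of_provisos θ h p hkK (hdec := hdec) (hdec' := hdec') hk s' hform t' E' hζ0m hqm
    (fun S₀ _ => (operandRows_at_history_of_termRows θ p k s'.init (t s'.init) (Ek s'.init) htrows₀ S₀).1) hζm hqm'
    (fun S _ => (operandRows_at_history_of_termRows θ p (k + 1) s' t' E' htrows S).1) hβ' Ω T ϑ jd hΩm hTm hθm hjm hΩbl hright hlaw hwS hinner₀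

end Summit.QuantumFields.YangMills.Theorems.BalabanUVNodesN11TStepOldBranchPrivateInnerChartOfProvisos

end
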